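import Literature.NumberTheory.GelbartRogawski1991.ThetaDichotomyVocabulary                -- ★ `xThetaGqsCM`, `xThetaCM`, `chiLocalSplittingsCM`
import Summits.HodgeConjecture.HodgeConjecture.Theorems.F0P2oYCoinvariantsCM                -- ★ p832817: the CM closer `r_N(ω_v|) ≃ 𝒮(L⁺_v)`
import Literature.RepresentationTheory.TwistedCoinvariants
import Literature.NumberTheory.Automorphic.JacquetModule
import Mathlib.LinearAlgebra.Isomorphisms
import HarnessLib

/-!
# Crux `H413`, programme P2, N3 road (a) — THE (S4)-APPLICATION WITH A JACQUET CHART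
# (`r_N(X_v) ≃ₗ[ℂ] S_Y ⧸ ⟨σ u s − χ_{f,v}(u) s⟩` for every Jacquet chart `π : 𝒮(L⁺_v^{n′}) ↠ S_Y` of `ω_v|_{U(Φ₃)(L⁺_v)}`; unconditionally at non-split `v`)

Cell hodgecm-mathlib (D-0151), FLOOR 0, crux item H413 = stmt-HodgeConjecture-24833, programme P2; N3 road notes
`F0/P2/B-p18/g28/N3-ROAD.v1∕v2.B-p18g28.md` (K1 lead B-p18 (g28)) §2 (S4) and v2 §1 «(a) = (S4) ∘ CM CLOSER ∘ (S5) — an M assembler file»;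
seat A-p12 (g17), the (a) closer owner (★ p832817 `F0P2oYCoinvariantsCM`).  WHY: letter (a) of the printed named fact
★ `GelbartRogawski1991.thetaType_nonsplit_jacquetModule` («`r_N(X_v) ≃ ℱ_v[ψθ]`», [GelbartRogawski1991 §3.2 p. 457; Kudla1986 Thm. 2.8]) is about
`((cmBorelTriple L 3 v).restrict (xThetaGqsCM …)).Coinvariants`, and ★ `xThetaGqsCM = xThetaCM ∘ localPiEquiv⁻¹ ∘ cmDatumLocalCongr T` is the
`χ_{f,v}`-TWISTED quotient `Literature.RepresentationTheory.TwistedCoinv.rep χ_{f,v} ω_v _ ∘ localLineInl` of the local Weil representation, while the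
Y-coinvariant machinery (★ p830834 … ★ p832817) computes `r_N` of the UNTWISTED `ω_v ∘ localLineInl ∘ κ`.  This file is the passage between the two.

WHAT IS PROVED (kernel, sorry-free; `k` any commutative ring in §1).
* §1 GENERIC.  `coinvariantsKer_restrict_eq`: the relation submodule of ★ `ParabolicTriple.restrict ρ` is that of `ρ.comp t.N.subtype`.
  **`exists_coinvariants_restrict_equiv_twistedCoinv`**: for `X : Representation k G (TwistedCoinv.Coinv ρW χ)` LAWFUL over `ρ : Representation k G S`
  (`X g [v]_W = [ρ g v]_W`), a parabolic triple `t`, and a JACQUET CHART `(π : S ↠ S₁, ker π = Coinvariants.ker (ρ.comp t.N.subtype), σ : Representation k H S₁,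
  π (ρW h v) = σ h (π v))`: `∃ e : (t.restrict X).Coinvariants ≃ₗ[k] TwistedCoinv.Coinv σ χ` with `e [[v]_W]_N = [π v]_σ`, `e⁻¹ [π v]_σ = [[v]_W]_N`
  (`nonempty_…` the `Nonempty` form); `exists_rep_chart_law`: the descended `σ` EXISTS as soon as `ρW(H)` commutes with `ρ(N)`;
  `exists_chart_of_coinvariants_equiv`: an identification `e : r_N(ρ) ≃ₗ S₁` gives the chart `π := e ∘ [·]_N`.  This is the consumer-side form — Literature
  carrier (the one ★ `xThetaCM` is built on; ★ p831392 `F0P2oTwistCoinvariantsCommute` (F0P3a-p08 (g10)) proves the swap over the token-identical but distinct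
  constants `HodgeCM.TwistedCoinv` and Mathlib's `ρN.Coinvariants`), external chart — of «twisting by the centre character and taking `N`-coinvariants commute».
* §2 PACKAGE LEVEL (any CM-free quadratic `E/F`, frame `(JV, JW)`, splitting package `𝓢 : FinLocalSplittings …`, any group `G` read along `κ : G →* U(J_V)(F_v)`,
  any `χ₁ : U(J_W)(F_v) →* ℂˣ`): `nonempty_coinvariants_restrict_twistedOmegaLoc_equiv` (§1 with the law `rfl`, ★ `TwistedCoinv.rep_mk`) and
  `exists_rep_chart_law_omegaLoc` (the centre `u·1ₙ` commutes with everything, ★ `commute_omegaLoc_localCenter`).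
* §3 THE LOCAL THETA TYPE.  **`nonempty_jacquet_xThetaGqsCM_equiv_of_chart`**: for EVERY Jacquet chart `(π, σ)` of
  `ω_v ∘ localLineInl ∘ localPiEquiv⁻¹ ∘ cmDatumLocalCongr T` along `(cmBorelTriple L 3 v).N`,
  `Nonempty (((cmBorelTriple L 3 v).restrict (xThetaGqsCM L e₁ dV hdV hdV0 μ hμ χf ε v T ha h)).Coinvariants ≃ₗ[ℂ] TwistedCoinv.Coinv σ χ_{f,v})`
  (`χ_{f,v}` = ★ `localCharOfCenter … χf v`) — the LEFT side is letter (a)'s, token for token.  **`exists_chart_nonempty_jacquet_xThetaGqsCM_equiv`**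
  (UNCONDITIONAL, `v` non-split): such a chart onto `S_Y = 𝒮(Fin 1 → L⁺_v)` and its `σ` EXIST (★ p832817 + §1), so `r_N(X_v) ≃ₗ[ℂ] S_Y ⧸ ⟨σ u s − χ_{f,v}(u) s⟩`.

WHAT REMAINS FOR LETTER (a) (road v2 §1 (S5), ONE hypothesis-shaped gap): the DICTIONARY `σ(u) = μ_v(u) · ω¹(γ_v, ψ_v)(u)` on `S_Y ≅` the carrier of
★ `lineWeilCM L e₀ (kernelLineCM dV) … μ hμ ε v` (the scalar `μ_v(u)` is road v2 §2 (D1)–(D3) at `α = u`; the `ω¹`-factor is print's (3.2.1) at `w = 0`), after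
which `TwistedCoinv.Coinv σ χ_{f,v}` is the `ψθ = χ_{f,v} μ_v⁻¹`-coinvariants of `ω¹|_{E¹_v}` = the weight space `ℱ_v[ψθ]` (compact abelian `E¹_v` acting smoothly).
KERNEL NOTE: never let the kernel compare the closer's spelling `((toRep ∘ s_v) ∘ (ι ∘ κ)) ∘ N.subtype` with `xThetaCM`'s `((omegaLoc ∘ ι) ∘ κ) ∘ N.subtype`
DEFINITIONALLY (it unfolds the CM package and exhausts memory); REWRITE with `FinLocalSplittings.omegaLoc` + `MonoidHom.comp_assoc` as in §3.
[GelbartRogawski1991 §3.2 p. 457, §5.2 p. 467; Kudla1986 Thm. 2.8; MoeglinVignerasWaldspurger1987 Chap. 3 §IV; BernsteinZelevinsky1976 §2.30–2.33; Liu2021 Def. 4.11.]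

## References
* [GelbartRogawski1991] S. Gelbart, J. Rogawski, *L-functions and Fourier–Jacobi coefficients for the unitary group U(3)*, Invent. Math. 105 (1991):
  §3.2 (3.2.1)–(3.2.3) p. 457; §5.2 p. 467 L8–11.
* [Kudla1986] S. Kudla, *On the local theta-correspondence*, Invent. Math. 83 (1986): Thm. 2.8.
* [MoeglinVignerasWaldspurger1987] C. Mœglin, M.-F. Vignéras, J.-L. Waldspurger, *Correspondances de Howe sur un corps p-adique*, LNM 1291 (1987): Chap. 3 §IV.
* [BernsteinZelevinsky1976] I. N. Bernstein, A. V. Zelevinsky, *Representations of the group GL(n, F) …*, Russian Math. Surveys 31 (1976): §2.30–2.33.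
* [BernsteinZelevinsky1977] I. N. Bernstein, A. V. Zelevinsky, *Induced representations of reductive p-adic groups I*, Ann. Sci. ÉNS 10 (1977): §1.8.
* [Liu2021] Y. Liu, *Fourier–Jacobi cycles and arithmetic relative trace formula*, Camb. J. Math. 9 (2021): Def. 4.11; App. D §D.1 Step 3.
-/

set_option autoImplicit false
set_option linter.dupNamespace false -- the mandated namespace repeats the single-problem summit's segment

noncomputable section

open Literature.RepresentationTheory Literature.NumberTheory.Automorphic Representation

namespace Summit.HodgeConjecture.HodgeConjecture.Cruxes.H413.F0P2oJacquetTwistSwapChart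

/-! ## §1 Generic: the `N`-coinvariants of a lawful twisted representation through a Jacquet chart -/

section Generic

variable {k : Type*} [CommRing k] {G H S S₁ : Type*} [Group G] [Group H] [AddCommGroup S] [Module k S] [AddCommGroup S₁] [Module k S₁]

/-- the relation submodule of ★ `ParabolicTriple.restrict ρ` (the `N`-action read on `N ⊓ P ≤ P`) IS the relation submodule of `ρ|_N`
(`N ≤ P`, ★ `ParabolicTriple.N_le`). [cite: BernsteinZelevinsky1977, §1.8] -/
theorem coinvariantsKer_restrict_eq (t : ParabolicTriple G) (ρ : Representation k G S) :
    Coinvariants.ker (t.restrict ρ) = Coinvariants.ker (ρ.comp t.N.subtype) := by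
  refine le_antisymm ?_ ?_
  · rw [Coinvariants.ker, Submodule.span_le]
    rintro _ ⟨⟨n, v⟩, rfl⟩
    exact Coinvariants.mem_ker_of_eq (ρ := ρ.comp t.N.subtype) ⟨((n : t.P) : G), Subgroup.mem_subgroupOf.1 n.2⟩ v _ rfl
  · rw [Coinvariants.ker, Submodule.span_le]
    rintro _ ⟨⟨n, v⟩, rfl⟩
    exact Coinvariants.mem_ker_of_eq (ρ := t.restrict ρ) ⟨⟨(n : G), t.N_le n.2⟩, Subgroup.mem_subgroupOf.2 n.2⟩ v _ rfl

variable (ρ : Representation k G S) (ρW : Representation k H S) (χ : H →* kˣ)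
  (X : Representation k G (TwistedCoinv.Coinv ρW χ))
  (hX : ∀ (g : G) (v : S), X g (TwistedCoinv.mk ρW χ v) = TwistedCoinv.mk ρW χ (ρ g v))
  (t : ParabolicTriple G)
  (π : S →ₗ[k] S₁) (hπ : Function.Surjective π) (hker : LinearMap.ker π = Coinvariants.ker (ρ.comp t.N.subtype))
  (σ : Representation k H S₁) (hσ : ∀ (h : H) (v : S), π (ρW h v) = σ h (π v))

include hX hπ hker hσ in
/-- **THE (S4)-APPLICATION WITH A JACQUET CHART.**  Let `X` be a representation of `G` on the `χ`-coinvariants `S ⧸ ⟨ρW h v − χ h v⟩`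
(★ `Literature.RepresentationTheory.TwistedCoinv.Coinv`, the carrier of ★ `xThetaCM`) that is LAWFUL over a representation `ρ` of `G` on `S`
(`X g [v]_W = [ρ g v]_W` — `rfl` for ★ `TwistedCoinv.rep χ ρV hc ∘ j` over `ρ = ρV ∘ j`), `t = (P, M, N)` a parabolic triple of `G`, and
`(π, σ)` a JACQUET CHART of `ρ` along `t.N`: `π : S ↠ S₁` linear onto with `ker π = ⟨ρ n v − v : n ∈ N⟩` (so `S₁` IS `r_N(ρ)`) and `σ` a
representation of `H` on `S₁` with `π (ρW h v) = σ h (π v)`.  Then the Jacquet module carrier `r_N(X) = (t.restrict X).Coinvariants` is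
`ℂ`-… `k`-linearly isomorphic to the `χ`-coinvariants of `σ`, **`r_N(X) ≃ₗ[k] S₁ ⧸ ⟨σ h s − χ h s⟩`**, by an `e` with `e [[v]_W]_N = [π v]_σ` and
`e⁻¹ [π v]_σ = [[v]_W]_N` — «twisting by the centre character and taking `N`-coinvariants commute», the consumer-side form (Literature carrier,
external chart) of ★ p831392 `F0P2oTwistCoinvariantsCommute.exists_linearEquiv_swap` (stated there over `HodgeCM.TwistedCoinv` and Mathlib's
`ρN.Coinvariants`).  Proof: both directions are two successive universal properties (★ `TwistedCoinv.lift`, Mathlib `Coinvariants.lift`,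
`LinearMap.quotKerEquivOfSurjective`). [cite: BernsteinZelevinsky1976, §2.30–2.33] [cite: MoeglinVignerasWaldspurger1987, Chap. 3 §IV]
[cite: Liu2021, Def. 4.11] -/
theorem exists_coinvariants_restrict_equiv_twistedCoinv :
    ∃ e : (t.restrict X).Coinvariants ≃ₗ[k] TwistedCoinv.Coinv σ χ,
      (∀ v : S, e (Coinvariants.mk (t.restrict X) (TwistedCoinv.mk ρW χ v)) = TwistedCoinv.mk σ χ (π v)) ∧
      (∀ v : S, e.symm (TwistedCoinv.mk σ χ (π v)) = Coinvariants.mk (t.restrict X) (TwistedCoinv.mk ρW χ v)) := by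
  -- forward: `S → Coinv σ χ`, `v ↦ [π v]_σ`, factors through `[·]_W` (transforms by `χ`) and then through `[·]_N` (`N`-invariant)
  have hF₀ : ∀ (h : H) (v : S), (TwistedCoinv.mk σ χ ∘ₗ π) (ρW h v) = ((χ h : kˣ) : k) • (TwistedCoinv.mk σ χ ∘ₗ π) v := by
    intro h v
    show TwistedCoinv.mk σ χ (π (ρW h v)) = ((χ h : kˣ) : k) • TwistedCoinv.mk σ χ (π v)
    rw [hσ, TwistedCoinv.mk_ρW]
  have hπN : ∀ (n : ↥(t.N.subgroupOf t.P)) (v : S), π (ρ ((n : t.P) : G) v) = π v := by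
    intro n v
    rw [← sub_eq_zero, ← map_sub, ← LinearMap.mem_ker, hker]
    exact Coinvariants.mem_ker_of_eq (ρ := ρ.comp t.N.subtype) ⟨((n : t.P) : G), Subgroup.mem_subgroupOf.1 n.2⟩ v _ rfl
  have hF₁ : ∀ n : ↥(t.N.subgroupOf t.P),
      TwistedCoinv.lift ρW χ (TwistedCoinv.mk σ χ ∘ₗ π) hF₀ ∘ₗ (t.restrict X) n =
        TwistedCoinv.lift ρW χ (TwistedCoinv.mk σ χ ∘ₗ π) hF₀ := fun n =>
    TwistedCoinv.ext_mk ρW χ fun v => by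
      show TwistedCoinv.lift ρW χ (TwistedCoinv.mk σ χ ∘ₗ π) hF₀ (X ((n : t.P) : G) (TwistedCoinv.mk ρW χ v)) =
        TwistedCoinv.lift ρW χ (TwistedCoinv.mk σ χ ∘ₗ π) hF₀ (TwistedCoinv.mk ρW χ v)
      rw [hX, TwistedCoinv.lift_mk, TwistedCoinv.lift_mk]
      show TwistedCoinv.mk σ χ (π (ρ ((n : t.P) : G) v)) = TwistedCoinv.mk σ χ (π v)
      rw [hπN]
  let F : (t.restrict X).Coinvariants →ₗ[k] TwistedCoinv.Coinv σ χ :=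
    Coinvariants.lift (t.restrict X) (TwistedCoinv.lift ρW χ (TwistedCoinv.mk σ χ ∘ₗ π) hF₀) hF₁
  have hFmk : ∀ v : S, F (Coinvariants.mk (t.restrict X) (TwistedCoinv.mk ρW χ v)) = TwistedCoinv.mk σ χ (π v) := fun v => by
    show Coinvariants.lift _ _ hF₁ (Coinvariants.mk (t.restrict X) (TwistedCoinv.mk ρW χ v)) = _
    rw [Coinvariants.lift_mk, TwistedCoinv.lift_mk]
    rfl
  -- backward: `S → r_N(X)`, `v ↦ [[v]_W]_N`, factors through `π` (kills `ker π = ⟨ρ n v − v⟩`) and then through `[·]_σ` (transforms by `χ`)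
  have hB₀ : LinearMap.ker π ≤ LinearMap.ker (Coinvariants.mk (t.restrict X) ∘ₗ TwistedCoinv.mk ρW χ) := by
    rw [hker, Coinvariants.ker, Submodule.span_le]
    rintro _ ⟨⟨n, v⟩, rfl⟩
    rw [SetLike.mem_coe, LinearMap.mem_ker, map_sub]
    show Coinvariants.mk (t.restrict X) (TwistedCoinv.mk ρW χ (ρ (n : G) v)) -
      Coinvariants.mk (t.restrict X) (TwistedCoinv.mk ρW χ v) = 0
    rw [← hX, sub_eq_zero]
    exact Coinvariants.mk_self_apply (t.restrict X) ⟨⟨(n : G), t.N_le n.2⟩, Subgroup.mem_subgroupOf.2 n.2⟩ _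
  let B₁ : S₁ →ₗ[k] (t.restrict X).Coinvariants :=
    (LinearMap.ker π).liftQ (Coinvariants.mk (t.restrict X) ∘ₗ TwistedCoinv.mk ρW χ) hB₀ ∘ₗ
      ((LinearMap.quotKerEquivOfSurjective π hπ).symm : S₁ →ₗ[k] S ⧸ LinearMap.ker π)
  have hB₁ : ∀ v : S, B₁ (π v) = Coinvariants.mk (t.restrict X) (TwistedCoinv.mk ρW χ v) := fun v => by
    show (LinearMap.ker π).liftQ _ hB₀ ((LinearMap.quotKerEquivOfSurjective π hπ).symm (π v)) = _
    rw [LinearMap.quotKerEquivOfSurjective_symm_apply]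
    rfl
  have hB₁χ : ∀ (h : H) (s : S₁), B₁ (σ h s) = ((χ h : kˣ) : k) • B₁ s := fun h s => by
    obtain ⟨v, rfl⟩ := hπ s
    rw [← hσ, hB₁, hB₁, TwistedCoinv.mk_ρW, map_smul]
  let B : TwistedCoinv.Coinv σ χ →ₗ[k] (t.restrict X).Coinvariants := TwistedCoinv.lift σ χ B₁ hB₁χ
  have hBmk : ∀ v : S, B (TwistedCoinv.mk σ χ (π v)) = Coinvariants.mk (t.restrict X) (TwistedCoinv.mk ρW χ v) := fun v => by
    show TwistedCoinv.lift σ χ B₁ hB₁χ (TwistedCoinv.mk σ χ (π v)) = _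
    rw [TwistedCoinv.lift_mk, hB₁]
  -- the two composites are the identity on generators
  have hFB : F ∘ₗ B = LinearMap.id :=
    TwistedCoinv.ext_mk σ χ fun s => by
      obtain ⟨v, rfl⟩ := hπ s
      show F (B (TwistedCoinv.mk σ χ (π v))) = TwistedCoinv.mk σ χ (π v)
      rw [hBmk, hFmk]
  have hBF : B ∘ₗ F = LinearMap.id :=
    Coinvariants.hom_ext (TwistedCoinv.ext_mk ρW χ fun v => by
      show B (F (Coinvariants.mk (t.restrict X) (TwistedCoinv.mk ρW χ v))) = Coinvariants.mk (t.restrict X) (TwistedCoinv.mk ρW χ v)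
      rw [hFmk, hBmk])
  refine ⟨LinearEquiv.ofLinear F B hFB hBF, hFmk, fun v => ?_⟩
  show B (TwistedCoinv.mk σ χ (π v)) = _
  exact hBmk v

include hX hπ hker hσ in
/-- the `Nonempty`-valued form quoted by `Nonempty (… ≃ₗ[ℂ] …)` consumers. [cite: BernsteinZelevinsky1976, §2.30–2.33] -/
theorem nonempty_coinvariants_restrict_equiv_twistedCoinv :
    Nonempty ((t.restrict X).Coinvariants ≃ₗ[k] TwistedCoinv.Coinv σ χ) :=
  (exists_coinvariants_restrict_equiv_twistedCoinv ρ ρW χ X hX t π hπ hker σ hσ).elim fun e _ => ⟨e⟩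

/-- **the descended action exists**: if every `ρW h` commutes with `ρ n`, `n ∈ N`, then `ρW` descends along any chart `π : S ↠ S₁` with
`ker π = ⟨ρ n v − v⟩` to a representation `σ` of `H` on `S₁` with `π (ρW h v) = σ h (π v)` (the centre of a dual pair commutes with everything:
★ `commute_omegaLoc_localCenter`). [cite: MoeglinVignerasWaldspurger1987, Chap. 3 §IV] [cite: Liu2021, App. D §D.1 Step 3] -/
theorem exists_rep_chart_law (hc : ∀ (n : ↥t.N) (h : H), Commute (ρ (n : G)) (ρW h))
    (π : S →ₗ[k] S₁) (hπ : Function.Surjective π) (hker : LinearMap.ker π = Coinvariants.ker (ρ.comp t.N.subtype)) :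
    ∃ σ : Representation k H S₁, ∀ (h : H) (v : S), π (ρW h v) = σ h (π v) := by
  -- `ρW h` preserves `ker π = ⟨ρ n v − v⟩`
  have hst : ∀ h : H, LinearMap.ker π ≤ (LinearMap.ker π).comap (ρW h) := fun h => by
    rw [hker, Coinvariants.ker, Submodule.span_le]
    rintro _ ⟨⟨n, v⟩, rfl⟩
    rw [SetLike.mem_coe, Submodule.mem_comap, map_sub]
    refine Coinvariants.mem_ker_of_eq (ρ := ρ.comp t.N.subtype) n (ρW h v) _ ?_
    show ρ (n : G) (ρW h v) - ρW h v = ρW h (ρ (n : G) v) - ρW h v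
    rw [← Module.End.mul_apply, hc n h, Module.End.mul_apply]
  -- the induced operator on `S ⧸ ker π ≃ S₁`
  let e : (S ⧸ LinearMap.ker π) ≃ₗ[k] S₁ := LinearMap.quotKerEquivOfSurjective π hπ
  let op : H → (S₁ →ₗ[k] S₁) := fun h =>
    (e : (S ⧸ LinearMap.ker π) →ₗ[k] S₁) ∘ₗ (LinearMap.ker π).mapQ (LinearMap.ker π) (ρW h) (hst h) ∘ₗ (e.symm : S₁ →ₗ[k] S ⧸ LinearMap.ker π)
  have hop : ∀ (h : H) (v : S), op h (π v) = π (ρW h v) := fun h v => by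
    show e ((LinearMap.ker π).mapQ (LinearMap.ker π) (ρW h) (hst h) (e.symm (π v))) = π (ρW h v)
    rw [LinearMap.quotKerEquivOfSurjective_symm_apply, Submodule.mapQ_apply]
    exact LinearMap.quotKerEquivOfSurjective_apply_mk π hπ _
  have hone : op 1 = 1 := LinearMap.ext fun s => by
    obtain ⟨v, rfl⟩ := hπ s
    rw [hop, map_one, Module.End.one_apply, Module.End.one_apply]
  have hmul : ∀ h h' : H, op (h * h') = op h * op h' := fun h h' => LinearMap.ext fun s => by
    obtain ⟨v, rfl⟩ := hπ s
    rw [hop, Module.End.mul_apply, hop, hop, map_mul, Module.End.mul_apply]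
  exact ⟨{ toFun := op, map_one' := hone, map_mul' := hmul }, fun h v => (hop h v).symm⟩

/-- **a Jacquet chart from an identification of the coinvariants**: `π := e ∘ [·]_N` is onto with `ker π = ⟨ρ n v − v⟩`.
[cite: BernsteinZelevinsky1976, §2.30–2.33] -/
theorem exists_chart_of_coinvariants_equiv {N : Type*} [Group N] (ρN : Representation k N S) (e : ρN.Coinvariants ≃ₗ[k] S₁) :
    ∃ π : S →ₗ[k] S₁, Function.Surjective π ∧ LinearMap.ker π = Coinvariants.ker ρN ∧ ∀ v, π v = e (Coinvariants.mk ρN v) :=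
  ⟨e.toLinearMap ∘ₗ Coinvariants.mk ρN, e.surjective.comp (Coinvariants.mk_surjective _),
    by rw [LinearEquiv.ker_comp]; exact Submodule.ker_mkQ _, fun _ => rfl⟩

end Generic

/-! ## §2 The local theta type: `r_N(X_v)` through a Jacquet chart of `ω_v|_{U(Φ₃)}` -/

section Package

open NumberField IsDedekindDomain
open scoped Matrix Kronecker
open Literature.NumberTheory.Automorphic.UnitaryGroup
open Literature.NumberTheory.GelbartRogawski1991.UnitaryDualPair Literature.NumberTheory.GelbartRogawski1991.UnitaryDualPair.WeilCoinv
open Literature.NumberTheory.GelbartRogawski1991.UnitaryDualPair.LocalSplitting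

variable (F E : Type) [Field F] [NumberField F] [Field E] [NumberField E] [Algebra F E] (c : E ≃ₐ[F] E) (N : ℕ) {n : ℕ} (e : Fin N × Fin 1 ≃ Fin n)
  (JV : Matrix (Fin N) (Fin N) E) (JW : Matrix (Fin 1) (Fin 1) E) {TV : Matrix (Fin N) (Fin N) F} {TW : Matrix (Fin 1) (Fin 1) F}
  [Algebra.IsQuadraticExtension F E] {δ : E} (hcδ : c δ = -δ) (hδ : δ ≠ 0) {d : F} (hd : δ * δ = algebraMap F E d) (hV : TV.IsSymm) (hW : TW.IsSymm)
  (hJV : JV = TV.map (algebraMap F E)) (hJW : JW = TW.map (algebraMap F E)) (hJW0 : JW 0 0 ≠ 0)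
  (𝓢 : FinLocalSplittings F E c n hcδ hδ hd (gram F e TV TW) (isSymm_gram F e hV hW) (reindex_kronecker_eq_gram_map F E e hJV hJW))
  (v : HeightOneSpectrum (𝓞 F)) {G : Type*} [Group G] (κ : G →* localPi E c N JV v) (t : ParabolicTriple G)
  (χ₁ : localPi E c 1 JW v →* ℂˣ)

/-- **`r_N` of the `χ₁`-twisted local Weil representation of a splitting package, read on any group `G` along `κ : G → U(J_V)(F_v)` and
`localLineInl`, through a Jacquet chart `(π, σ)` of `ω_v ∘ localLineInl ∘ κ` along `t.N`** — §1 with the law `rfl` (★ `TwistedCoinv.rep_mk`).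
[cite: Liu2021, Def. 4.11; App. D §D.1 Step 3] [cite: BernsteinZelevinsky1976, §2.30–2.33] -/
theorem nonempty_coinvariants_restrict_twistedOmegaLoc_equiv {S₁ : Type*} [AddCommGroup S₁] [Module ℂ S₁]
    (π : SchwartzBruhat (Fin n → v.adicCompletion F) →ₗ[ℂ] S₁) (hπ : Function.Surjective π)
    (hker : LinearMap.ker π =
      Coinvariants.ker ((((𝓢.omegaLoc v).comp (localLineInl E c N e JV JW v)).comp κ).comp t.N.subtype))
    (σ : Representation ℂ (localPi E c 1 JW v) S₁)
    (hσ : ∀ (u : localPi E c 1 JW v) (f : SchwartzBruhat (Fin n → v.adicCompletion F)),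
      π (𝓢.omegaLoc v (localCenter E c n (Matrix.reindex e e (JV ⊗ₖ JW)) JW hJW0 v u) f) = σ u (π f)) :
    Nonempty ((t.restrict (((show Representation ℂ (localPi E c n (Matrix.reindex e e (JV ⊗ₖ JW)) v) _ from
        TwistedCoinv.rep χ₁ (𝓢.omegaLoc v) (commute_omegaLoc_localCenter F E c N e JV JW hcδ hδ hd hV hW hJV hJW hJW0 𝓢 v)).comp
        (localLineInl E c N e JV JW v)).comp κ)).Coinvariants ≃ₗ[ℂ] TwistedCoinv.Coinv σ χ₁) :=
  nonempty_coinvariants_restrict_equiv_twistedCoinv (((𝓢.omegaLoc v).comp (localLineInl E c N e JV JW v)).comp κ)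
    (show Representation ℂ (localPi E c 1 JW v) _ from
      (𝓢.omegaLoc v).comp (localCenter E c n (Matrix.reindex e e (JV ⊗ₖ JW)) JW hJW0 v)) χ₁ _ (fun _ _ => rfl) t π hπ hker σ hσ

/-- **the descended centre action exists for every Jacquet chart** of `ω_v ∘ localLineInl ∘ κ` (the centre `u·1ₙ` commutes with `U(J)(F_v)`,
★ `commute_omegaLoc_localCenter`; §1 `exists_rep_chart_law`). [cite: Liu2021, App. D §D.1 Step 3] [cite: MoeglinVignerasWaldspurger1987, Chap. 3 §IV] -/
theorem exists_rep_chart_law_omegaLoc {S₁ : Type*} [AddCommGroup S₁] [Module ℂ S₁]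
    (π : SchwartzBruhat (Fin n → v.adicCompletion F) →ₗ[ℂ] S₁) (hπ : Function.Surjective π)
    (hker : LinearMap.ker π =
      Coinvariants.ker ((((𝓢.omegaLoc v).comp (localLineInl E c N e JV JW v)).comp κ).comp t.N.subtype)) :
    ∃ σ : Representation ℂ (localPi E c 1 JW v) S₁, ∀ (u : localPi E c 1 JW v) (f : SchwartzBruhat (Fin n → v.adicCompletion F)),
      π (𝓢.omegaLoc v (localCenter E c n (Matrix.reindex e e (JV ⊗ₖ JW)) JW hJW0 v u) f) = σ u (π f) :=
  exists_rep_chart_law (((𝓢.omegaLoc v).comp (localLineInl E c N e JV JW v)).comp κ)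
    (show Representation ℂ (localPi E c 1 JW v) _ from
      (𝓢.omegaLoc v).comp (localCenter E c n (Matrix.reindex e e (JV ⊗ₖ JW)) JW hJW0 v)) t
    (fun _ u => commute_omegaLoc_localCenter F E c N e JV JW hcδ hδ hd hV hW hJV hJW hJW0 𝓢 v _ u) π hπ hker

end Package

/-! ## §3 `r_N(X_v(μ, ε, χ_f))` on `U(Φ₃)(L⁺_v)`: through any chart, and unconditionally at a non-split place -/

section CM

open NumberField IsDedekindDomain
open scoped Matrix Kronecker
open Literature.NumberTheory Literature.NumberTheory.Automorphic.UnitaryGroup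
open Literature.NumberTheory.Automorphic.IdeleClassGroup
open Literature.NumberTheory.Automorphic.Liu2021 Literature.NumberTheory.Automorphic.Liu2021.Def411WeilCarriers
open Literature.NumberTheory.GelbartRogawski1991 Literature.NumberTheory.GelbartRogawski1991.UnitaryDualPair
open Literature.NumberTheory.GelbartRogawski1991.UnitaryDualPair.WeilCoinv Literature.NumberTheory.GelbartRogawski1991.UnitaryDualPair.LocalSplitting
open Literature.NumberTheory.GaloisRepresentations Literature.NumberTheory.Rogawski1990
open Literature.RepresentationTheory.Liu2021 Literature.RepresentationTheory.HeisenbergGroup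

variable (L : Type) [Field L] [NumberField L] [IsCMField L]

set_option synthInstance.maxHeartbeats 400000 in
set_option maxHeartbeats 8000000 in
/-- **`r_N(X_v) ≃ₗ[ℂ] (S₁)_{σ, χ_{f,v}}` FOR EVERY JACQUET CHART `(π, σ)` of `ω_v ∘ localLineInl ∘ localPiEquiv⁻¹ ∘ cmDatumLocalCongr T` along the
unipotent radical of ★ `cmBorelTriple L 3 v`** — the literal ★ `xThetaGqsCM` reading of §2: the Jacquet module carrier of Liu's local theta type
`X_v(μ, ε, χ_f)` on `U(Φ₃)(L⁺_v)` is the `χ_{f,v}`-coinvariants (★ `localCharOfCenter … χf v`) of the descended centre action `σ` on the chart's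
target.  With a chart onto `S_Y = 𝒮(Fin 1 → L⁺_v)` (★ p832817 and `exists_chart_nonempty_jacquet_xThetaGqsCM_equiv` below) this is letter (a) of
★ `thetaType_nonsplit_jacquetModule` up to the one remaining identification `(S_Y)_{σ, χ_{f,v}} ≃ ℱ_v[ψθ]` (N3 road (S5)).
[cite: GelbartRogawski1991, §3.2 (3.2.1)–(3.2.3) p. 457] [cite: Kudla1986, Thm. 2.8] [cite: Liu2021, Def. 4.11] -/
theorem nonempty_jacquet_xThetaGqsCM_equiv_of_chart {n' : ℕ} (e₁ : Fin 3 × Fin 1 ≃ Fin n') (dV : Fin 3 → L)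
    (hdV : ∀ i, IsCMField.complexConj L (dV i) = dV i) (hdV0 : ∀ i, dV i ≠ 0)
    (μ : Literature.NumberTheory.Automorphic.IdeleClassGroup L →ₜ* Circle) (hμ : IsConjugateSymplectic L μ)
    (χf : UnitaryGroup.finAdelicOne (↥(maximalRealSubfield L)) L (IsCMField.complexConj L) →* ℂˣ) (ε : (↥(maximalRealSubfield L))ˣ)
    (v : HeightOneSpectrum (𝓞 ↥(maximalRealSubfield L)))
    (T : GL (Fin 3) (UnitaryGroup.LocalRing L v)) {a : UnitaryGroup.LocalRing L v} (ha : IsUnit a)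
    (h : formCongr (conjLocal L (IsCMField.complexConj L) v) T ((Matrix.diagonal dV).map (algebraMap L (UnitaryGroup.LocalRing L v))) =
      a • (Matrix.of fun i j : Fin 3 => if i.val + j.val + 1 = 3 then (1 : L) else 0).map (algebraMap L (UnitaryGroup.LocalRing L v)))
    {S₁ : Type*} [AddCommGroup S₁] [Module ℂ S₁]
    (π : SchwartzBruhat (Fin n' → v.adicCompletion ↥(maximalRealSubfield L)) →ₗ[ℂ] S₁) (hπ : Function.Surjective π)
    (hker : LinearMap.ker π = Coinvariants.ker
      (((((chiLocalSplittingsCM L e₁ dV hdV hdV0 (toHeckeCharacter L μ) ((isOscillatorChar_toHeckeCharacter_iff μ).mpr hμ) ε).omegaLoc v).comp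
        (localLineInl L (IsCMField.complexConj L) 3 e₁ (Matrix.diagonal dV) (JW (↥(maximalRealSubfield L)) L ε) v)).comp
        ((localPiEquiv L (IsCMField.complexConj L) 3 (Matrix.diagonal dV) v).symm.toMulEquiv.toMonoidHom.comp
          (cmDatumLocalCongr L v T ha h : Gqs L v ≃ₜ* (cmDatum L 3 (Matrix.diagonal dV)).Local v).toMulEquiv.toMonoidHom)).comp
        (cmBorelTriple L 3 v).N.subtype))
    (σ : Representation ℂ (localPi L (IsCMField.complexConj L) 1 (JW (↥(maximalRealSubfield L)) L ε) v) S₁)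
    (hσ : ∀ (u : localPi L (IsCMField.complexConj L) 1 (JW (↥(maximalRealSubfield L)) L ε) v)
      (f : SchwartzBruhat (Fin n' → v.adicCompletion ↥(maximalRealSubfield L))),
      π ((chiLocalSplittingsCM L e₁ dV hdV hdV0 (toHeckeCharacter L μ) ((isOscillatorChar_toHeckeCharacter_iff μ).mpr hμ) ε).omegaLoc v
        (localCenter L (IsCMField.complexConj L) n' (Matrix.reindex e₁ e₁ (Matrix.diagonal dV ⊗ₖ JW (↥(maximalRealSubfield L)) L ε))
          (JW (↥(maximalRealSubfield L)) L ε) (JW_apply_ne_zero (↥(maximalRealSubfield L)) L ε) v u) f) = σ u (π f)) :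
    Nonempty (((cmBorelTriple L 3 v).restrict (xThetaGqsCM L e₁ dV hdV hdV0 μ hμ χf ε v T ha h)).Coinvariants ≃ₗ[ℂ]
      TwistedCoinv.Coinv σ (localCharOfCenter (↥(maximalRealSubfield L)) L (IsCMField.complexConj L)
        (JW (↥(maximalRealSubfield L)) L ε) (JW_apply_ne_zero (↥(maximalRealSubfield L)) L ε) χf v)) :=
  nonempty_coinvariants_restrict_twistedOmegaLoc_equiv (↥(maximalRealSubfield L)) L (IsCMField.complexConj L) 3 e₁ (Matrix.diagonal dV)
    (JW (↥(maximalRealSubfield L)) L ε) (complexConj_imagUnit L) (imagUnit_ne_zero L) (imagUnit_mul_self L)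
    (realDiagonal_isSymm L dV hdV) (isSymm_TW (↥(maximalRealSubfield L)) ε) (realDiagonal_map L dV hdV).symm
    (JW_eq (↥(maximalRealSubfield L)) L ε) (JW_apply_ne_zero (↥(maximalRealSubfield L)) L ε)
    (chiLocalSplittingsCM L e₁ dV hdV hdV0 (toHeckeCharacter L μ) ((isOscillatorChar_toHeckeCharacter_iff μ).mpr hμ) ε) v
    ((localPiEquiv L (IsCMField.complexConj L) 3 (Matrix.diagonal dV) v).symm.toMulEquiv.toMonoidHom.comp
      (cmDatumLocalCongr L v T ha h : Gqs L v ≃ₜ* (cmDatum L 3 (Matrix.diagonal dV)).Local v).toMulEquiv.toMonoidHom)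
    (cmBorelTriple L 3 v)
    (localCharOfCenter (↥(maximalRealSubfield L)) L (IsCMField.complexConj L) (JW (↥(maximalRealSubfield L)) L ε)
      (JW_apply_ne_zero (↥(maximalRealSubfield L)) L ε) χf v)
    π hπ hker σ hσ

set_option synthInstance.maxHeartbeats 400000 in
set_option maxHeartbeats 8000000 in
/-- **UNCONDITIONAL AT A NON-SPLIT PLACE — `r_N(X_v(μ, ε, χ_f))` IS the `χ_{f,v}`-coinvariants of the descended centre action on
`S_Y = 𝒮(Fin 1 → L⁺_v)`.**  For `v` not split in `L` (`hv`) and every form congruence `(T, a, h)`: there are a Jacquet chart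
`π : 𝒮(Fin n' → L⁺_v) ↠ 𝒮(Fin 1 → L⁺_v)` of `ω_v ∘ localLineInl ∘ localPiEquiv⁻¹ ∘ cmDatumLocalCongr T` along `N` (★ p832817
`F0P2oYCoinvariantsCM.exists_coinvariants_equiv_schwartz_of_nonsplit` composed with `[·]_N`) and a representation `σ` of `U((ε))(L⁺_v) = E¹_v` on
`𝒮(Fin 1 → L⁺_v)` through which the centre `u·1` acts (`π (ω_v(u·1) f) = σ u (π f)`), and for them
**`r_N(X_v) ≃ₗ[ℂ] 𝒮(Fin 1 → L⁺_v) ⧸ ⟨σ u s − χ_{f,v}(u) s⟩`**.  Letter (a) of ★ `thetaType_nonsplit_jacquetModule` is this plus the (S5)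
dictionary `σ ≅ μ_v ⊗ ω¹(γ_v, ψ_v)|_{E¹_v}` (★ `lineWeilCM`), which turns the right side into `ℱ_v[ψθ]`, `ψθ = χ_{f,v} μ_v⁻¹`.
[cite: GelbartRogawski1991, §3.2 (3.2.1)–(3.2.3) p. 457; §5.2 p. 467 L8–11] [cite: Kudla1986, Thm. 2.8] [cite: MoeglinVignerasWaldspurger1987, Chap. 3 §IV.5]
[cite: Liu2021, Def. 4.11; App. D §D.1 Step 3] -/
theorem exists_chart_nonempty_jacquet_xThetaGqsCM_equiv {n' : ℕ} (e₁ : Fin 3 × Fin 1 ≃ Fin n') (dV : Fin 3 → L)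
    (hdV : ∀ i, IsCMField.complexConj L (dV i) = dV i) (hdV0 : ∀ i, dV i ≠ 0)
    (μ : Literature.NumberTheory.Automorphic.IdeleClassGroup L →ₜ* Circle) (hμ : IsConjugateSymplectic L μ)
    (χf : UnitaryGroup.finAdelicOne (↥(maximalRealSubfield L)) L (IsCMField.complexConj L) →* ℂˣ) (ε : (↥(maximalRealSubfield L))ˣ)
    (v : HeightOneSpectrum (𝓞 ↥(maximalRealSubfield L))) (hv : ∀ w : PlacesOver L v, IsCMField.complexConj L • w.1 = w.1)
    (T : GL (Fin 3) (UnitaryGroup.LocalRing L v)) {a : UnitaryGroup.LocalRing L v} (ha : IsUnit a)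
    (h : formCongr (conjLocal L (IsCMField.complexConj L) v) T ((Matrix.diagonal dV).map (algebraMap L (UnitaryGroup.LocalRing L v))) =
      a • (Matrix.of fun i j : Fin 3 => if i.val + j.val + 1 = 3 then (1 : L) else 0).map (algebraMap L (UnitaryGroup.LocalRing L v))) :
    ∃ (π : SchwartzBruhat (Fin n' → v.adicCompletion ↥(maximalRealSubfield L)) →ₗ[ℂ]
        SchwartzBruhat (Fin 1 → v.adicCompletion ↥(maximalRealSubfield L)))
      (σ : Representation ℂ (localPi L (IsCMField.complexConj L) 1 (JW (↥(maximalRealSubfield L)) L ε) v)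
        (SchwartzBruhat (Fin 1 → v.adicCompletion ↥(maximalRealSubfield L)))),
      Function.Surjective π ∧
      LinearMap.ker π = Coinvariants.ker
        (((((chiLocalSplittingsCM L e₁ dV hdV hdV0 (toHeckeCharacter L μ) ((isOscillatorChar_toHeckeCharacter_iff μ).mpr hμ) ε).omegaLoc v).comp
          (localLineInl L (IsCMField.complexConj L) 3 e₁ (Matrix.diagonal dV) (JW (↥(maximalRealSubfield L)) L ε) v)).comp
          ((localPiEquiv L (IsCMField.complexConj L) 3 (Matrix.diagonal dV) v).symm.toMulEquiv.toMonoidHom.comp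
            (cmDatumLocalCongr L v T ha h : Gqs L v ≃ₜ* (cmDatum L 3 (Matrix.diagonal dV)).Local v).toMulEquiv.toMonoidHom)).comp
          (cmBorelTriple L 3 v).N.subtype) ∧
      (∀ (u : localPi L (IsCMField.complexConj L) 1 (JW (↥(maximalRealSubfield L)) L ε) v)
        (f : SchwartzBruhat (Fin n' → v.adicCompletion ↥(maximalRealSubfield L))),
        π ((chiLocalSplittingsCM L e₁ dV hdV hdV0 (toHeckeCharacter L μ) ((isOscillatorChar_toHeckeCharacter_iff μ).mpr hμ) ε).omegaLoc v
          (localCenter L (IsCMField.complexConj L) n' (Matrix.reindex e₁ e₁ (Matrix.diagonal dV ⊗ₖ JW (↥(maximalRealSubfield L)) L ε))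
            (JW (↥(maximalRealSubfield L)) L ε) (JW_apply_ne_zero (↥(maximalRealSubfield L)) L ε) v u) f) = σ u (π f)) ∧
      Nonempty (((cmBorelTriple L 3 v).restrict (xThetaGqsCM L e₁ dV hdV hdV0 μ hμ χf ε v T ha h)).Coinvariants ≃ₗ[ℂ]
        TwistedCoinv.Coinv σ (localCharOfCenter (↥(maximalRealSubfield L)) L (IsCMField.complexConj L)
          (JW (↥(maximalRealSubfield L)) L ε) (JW_apply_ne_zero (↥(maximalRealSubfield L)) L ε) χf v)) := by
  -- ★ p832817: `r_N(ω_v|) ≃ₗ 𝒮(Fin 1 → L⁺_v)` for the `θ`-normalised CM package (any package would do)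
  obtain ⟨e⟩ := F0P2oYCoinvariantsCM.exists_coinvariants_equiv_schwartz_of_nonsplit L e₁ dV hdV hdV0 ε v hv
    (chiLocalSplittingsCM L e₁ dV hdV hdV0 (toHeckeCharacter L μ) ((isOscillatorChar_toHeckeCharacter_iff μ).mpr hμ) ε) T ha h
  -- the restriction to `N` in this file's spelling (`omegaLoc`, `toMulEquiv.toMonoidHom`), as an opaque local
  obtain ⟨ρN, hρN⟩ : ∃ ρN : Representation ℂ ↥(cmBorelTriple L 3 v).N (SchwartzBruhat (Fin n' → v.adicCompletion ↥(maximalRealSubfield L))),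
      ρN = ((((chiLocalSplittingsCM L e₁ dV hdV hdV0 (toHeckeCharacter L μ) ((isOscillatorChar_toHeckeCharacter_iff μ).mpr hμ) ε).omegaLoc v).comp
        (localLineInl L (IsCMField.complexConj L) 3 e₁ (Matrix.diagonal dV) (JW (↥(maximalRealSubfield L)) L ε) v)).comp
        ((localPiEquiv L (IsCMField.complexConj L) 3 (Matrix.diagonal dV) v).symm.toMulEquiv.toMonoidHom.comp
          (cmDatumLocalCongr L v T ha h : Gqs L v ≃ₜ* (cmDatum L 3 (Matrix.diagonal dV)).Local v).toMulEquiv.toMonoidHom)).comp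
        (cmBorelTriple L 3 v).N.subtype := ⟨_, rfl⟩
  -- the closer's spelling equals `ρN` by `omegaLoc`'s definition and reassociation — a REWRITE (see the module docstring's KERNEL NOTE)
  have hρ : (((MpPsi.toRep (localSchrodinger (↥(maximalRealSubfield L)) n'
          (gram (↥(maximalRealSubfield L)) e₁ (realDiagonal L dV hdV) (TW (↥(maximalRealSubfield L)) ε)) v)).comp
        ((chiLocalSplittingsCM L e₁ dV hdV hdV0 (toHeckeCharacter L μ) ((isOscillatorChar_toHeckeCharacter_iff μ).mpr hμ) ε).s v)).comp
        ((localLineInl L (IsCMField.complexConj L) 3 e₁ (Matrix.diagonal dV) (JW (↥(maximalRealSubfield L)) L ε) v).comp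
          ((localPiEquiv L (IsCMField.complexConj L) 3 (Matrix.diagonal dV) v).symm.toMonoidHom.comp
            (cmDatumLocalCongr L v T ha h).toMonoidHom))).comp (cmBorelTriple L 3 v).N.subtype = ρN := by
    rw [hρN]
    simp only [FinLocalSplittings.omegaLoc, MonoidHom.comp_assoc]
  have e' : Representation.Coinvariants ρN ≃ₗ[ℂ] SchwartzBruhat (Fin 1 → v.adicCompletion ↥(maximalRealSubfield L)) := by
    rw [← hρ]; exact e
  -- the chart `π := e' ∘ [·]_N` and the descended centre action through it
  obtain ⟨π, hπ, hker, -⟩ := exists_chart_of_coinvariants_equiv ρN e'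
  rw [hρN] at hker
  obtain ⟨σ, hσ⟩ := exists_rep_chart_law_omegaLoc (↥(maximalRealSubfield L)) L (IsCMField.complexConj L) 3 e₁ (Matrix.diagonal dV)
    (JW (↥(maximalRealSubfield L)) L ε) (complexConj_imagUnit L) (imagUnit_ne_zero L) (imagUnit_mul_self L)
    (realDiagonal_isSymm L dV hdV) (isSymm_TW (↥(maximalRealSubfield L)) ε) (realDiagonal_map L dV hdV).symm
    (JW_eq (↥(maximalRealSubfield L)) L ε) (JW_apply_ne_zero (↥(maximalRealSubfield L)) L ε)
    (chiLocalSplittingsCM L e₁ dV hdV hdV0 (toHeckeCharacter L μ) ((isOscillatorChar_toHeckeCharacter_iff μ).mpr hμ) ε) v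
    ((localPiEquiv L (IsCMField.complexConj L) 3 (Matrix.diagonal dV) v).symm.toMulEquiv.toMonoidHom.comp
      (cmDatumLocalCongr L v T ha h : Gqs L v ≃ₜ* (cmDatum L 3 (Matrix.diagonal dV)).Local v).toMulEquiv.toMonoidHom)
    (cmBorelTriple L 3 v) π hπ hker
  exact ⟨π, σ, hπ, hker, hσ, nonempty_jacquet_xThetaGqsCM_equiv_of_chart L e₁ dV hdV hdV0 μ hμ χf ε v T ha h π hπ hker σ hσ⟩

end CM

end Summit.HodgeConjecture.HodgeConjecture.Cruxes.H413.F0P2oJacquetTwistSwapChart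

end
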